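/-
Copyright (c) 2026. All rights reserved.
Released under Apache 2.0 license as described in the file LICENSE.
Authors: abc-iut cell, seat abc-iut-w6-d025 (block C / W6 cone prover; node `AbsTopIII:Cor4.5(v)`).
-/
import Literature.AnabelianGeometry.AbsoluteAnabelian.AbsTopIII.AutHolLogFrobeniusNexusRigidityProofs
import Literature.AnabelianGeometry.Anabelioids.Induction
import Mathlib.Topology.Algebra.ClopenNhdofOne
import HarnessLib

/-!
# [AbsTopIII] Cor 4.5 (v) at the Galois-category instance: the CENTRE of `Π` is the obstruction

S. Mochizuki, *Topics in Absolute Anabelian Geometry III*, Cor 4.5 (v) p. 109, Prop 4.2 (i) p. 105 with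
its proof p. 106 l. 18–19 ("the id-rigidity of `EA` follows immediately from the slimness assertion of
Lemma 4.3"), §0 p. 27 (rigid functors, id-rigid categories) of the kurims manuscript (lit key
`paper:url-5493eb38cbb7`; bib key `MochizukiAbsTopIII2015`); S. Mochizuki, *Semi-graphs of
anabelioids*, §0 p. 6 ("`B(G)` is slim iff `Z_G(H) = {1}` for every open `H`"; bib key
`MochizukiSemiAnbd2006`).  PROOF-ONLY companion (abc-iut cell, node `AbsTopIII:Cor4.5(v)`; seat
abc-iut-w6-d025) of `AutHolLogFrobeniusNexusRigidityProofs.lean` (`cor_4_5_v_arch_ofGaloisCategory_iff`: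
at abc-iut-L4-t10's Galois-category instance `EA = B(Π)`, item (v) ⟺ `B(Π)` id-rigid).  No new notion.

The centre variant of [SemiAnbd] §0, necessity half: **a central element `z ≠ 1` of a profinite group
`Π` is a non-trivial automorphism of the identity functor of `B(Π)`** (`b ↦ z·b` on every finite
continuous `Π`-set — equivariant because `z` is central, natural along every `Π`-map, and `≠ id` on the
coset object `Π/K` for an open normal `K ∌ z`).  Hence:

* `exists_idIso_bCat_of_mem_center`, `not_isIdRigid_bCat_of_mem_center`,
  `center_eq_bot_of_isIdRigid_bCat` — `B(Π)` id-rigid ⟹ `Z(Π) = 1`;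
* `AbsTopIII.center_eq_bot_of_cor_4_5_v_arch_ofGaloisCategory` — **Cor 4.5 (v) at the Galois-category
  instance forces `Z(Π) = 1`**; `AbsTopIII.not_cor_4_5_v_arch_ofGaloisCategory_of_mem_center`, and
  `AbsTopIII.not_cor_4_5_v_arch_ofGaloisCategory_of_comm` — for every NON-TRIVIAL ABELIAN profinite `Π`
  (e.g. `Ẑ ≅ G_{𝔽_p}`) item (v) FAILS at `B(Π)`: a Galois-category countermodel in the archimedean
  direction, complementing the positive slim instance `cor_4_5_v_arch_ofGaloisCategory` (abc-iut-L4-t10's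
  `G_{ℚ_p}` example) — slim ⟹ centre-free, and the centre is exactly what item (v) sees of Lemma 4.3 at
  this instance.

Honest scope: the sufficiency half "`Z(Π) = 1 ⟹ B(Π)` id-rigid" (true for profinite `Π`, by the
compactness argument of [SemiAnbd] §0) is NOT proved here; the tree has the stronger-hypothesis form
`isIdRigid_bCat_of_isSlimGroup` (abc-iut-w5-d215).  Refereed pre-IUT material; nothing here bears on
[IUTchIII] Cor. 3.12 or takes a side; model-level ≠ node-level.
-/

namespace Literature.AnabelianGeometry.AbsoluteAnabelian

open _root_.CategoryTheory
open Literature.AlgebraicGeometry.Frobenioids (BCat IsSlimGroup)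
open Literature.AnabelianGeometry.Anabelioids (Induction.quotObj Induction.basePt
  Induction.quotObj_smul_mk)

universe u

section Center

variable {G : Type u} [Group G] [TopologicalSpace G]

/-- Equivariance of a morphism of `B(G)`, pointwise. [folklore] -/
private theorem bCat_hom_smul {X Y : BCat G} (f : X ⟶ Y) (g : G) (x : X.obj.V) :
    f.hom.hom (g • x) = g • f.hom.hom x := by
  have e := ConcreteCategory.congr_hom (f.hom.comm g) x
  simp only [FintypeCat.comp_apply] at e
  exact e

/-- **A central element acts as an automorphism of the identity functor of `B(G)`**: for
`z ∈ Z(G)`, `b ↦ z · b` is a `G`-equivariant bijection of every finite continuous `G`-set, natural along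
every `G`-map (centre variant of the construction of [SemiAnbd] §0 "`B(G)` slim iff `G` slim", (⇒)).
[cite: MochizukiSemiAnbd2006, Section 0 p.6] -/
theorem exists_idIso_bCat_of_mem_center (z : G) (hz : z ∈ Subgroup.center G) :
    ∃ α : 𝟭 (BCat G) ≅ 𝟭 (BCat G), ∀ (X : BCat G) (x : X.obj.V), (α.hom.app X).hom.hom x = z • x := by
  classical
  have hzc : ∀ g : G, g * z = z * g := Subgroup.mem_center_iff.mp hz
  let σ : ∀ X : BCat G, X.obj.V ≃ X.obj.V := fun X =>
    { toFun := fun b => z • b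
      invFun := fun b => z⁻¹ • b
      left_inv := fun b => inv_smul_smul z b
      right_inv := fun b => smul_inv_smul z b }
  let ι : ∀ X : BCat G, X ≅ X := fun X =>
    ObjectProperty.isoMk _ (Action.mkIso (FintypeCat.equivEquivIso (σ X)) fun g => by
      apply FintypeCat.hom_ext
      intro b
      change z • (g • b) = g • (z • b)
      rw [smul_smul, smul_smul, hzc g])
  refine ⟨NatIso.ofComponents (fun X => ι X) fun {X Y} f => ?_, fun X x => rfl⟩
  apply ObjectProperty.hom_ext
  apply Action.hom_ext
  apply FintypeCat.hom_ext
  intro b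
  change z • f.hom.hom b = f.hom.hom (z • b)
  exact (bCat_hom_smul f z b).symm

variable [IsTopologicalGroup G] [CompactSpace G] [TotallyDisconnectedSpace G]

/-- **A profinite group with non-trivial centre has a non-id-rigid `B(G)`**: for central `z ≠ 1` pick an
open normal subgroup `K ∌ z` (profinite groups have a basis of open normal subgroups at `1`); the
automorphism `b ↦ z · b` of `𝟭_{B(G)}` moves the base point of the coset object `G/K`.
[cite: MochizukiSemiAnbd2006, Section 0 p.6] -/
theorem not_isIdRigid_bCat_of_mem_center {z : G} (hz : z ∈ Subgroup.center G) (hz1 : z ≠ 1) :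
    ¬ IsIdRigid (BCat G) := by
  classical
  intro hrig
  obtain ⟨K, hK⟩ := ProfiniteGrp.exist_openNormalSubgroup_sub_open_nhds_of_one
    (isOpen_compl_singleton (x := z)) (Set.mem_compl_singleton_iff.mpr (Ne.symm hz1))
  have hzK : z ∉ K.toSubgroup := fun h => (Set.mem_compl_singleton_iff.mp (hK h)) rfl
  haveI : Finite (G ⧸ K.toSubgroup) := Subgroup.quotient_finite_of_isOpen K.toSubgroup K.isOpen'
  obtain ⟨α, hα⟩ := exists_idIso_bCat_of_mem_center z hz
  have h1 := hα (Induction.quotObj K.toSubgroup K.isOpen') (Induction.basePt K.toSubgroup K.isOpen')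
  rw [hrig α] at h1
  change ((1 : G) : G ⧸ K.toSubgroup) = z • (((1 : G) : G ⧸ K.toSubgroup) : (G ⧸ₐ K.toSubgroup).V) at h1
  rw [Induction.quotObj_smul_mk, mul_one, eq_comm, QuotientGroup.eq, mul_one] at h1
  exact hzK ((Subgroup.inv_mem_iff _).mp h1)

/-- **`B(G)` id-rigid ⟹ `Z(G) = 1`** for profinite `G`. [cite: MochizukiSemiAnbd2006, Section 0 p.6] -/
theorem center_eq_bot_of_isIdRigid_bCat (h : IsIdRigid (BCat G)) : Subgroup.center G = ⊥ := by
  rw [eq_bot_iff]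
  intro z hz
  rw [Subgroup.mem_bot]
  by_contra hz1
  exact not_isIdRigid_bCat_of_mem_center hz hz1 h

/-- Slim profinite groups are centre-free (through `B(G)`: slim ⟹ `B(G)` id-rigid ⟹ `Z(G) = 1`; of
course also directly, `Z(G) = Z_G(G)`). [cite: MochizukiSemiAnbd2006, Section 0 p.6] -/
theorem center_eq_bot_of_isSlimGroup {G : Type} [Group G] [TopologicalSpace G] [IsTopologicalGroup G]
    [CompactSpace G] [T2Space G] [TotallyDisconnectedSpace G] (hG : IsSlimGroup G) :
    Subgroup.center G = ⊥ :=
  center_eq_bot_of_isIdRigid_bCat (isIdRigid_bCat_of_isSlimGroup G hG)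

end Center

/-! ### Cor 4.5 (v) at the Galois-category instance and the centre of `Π` -/

namespace AbsTopIII

variable {G : Type} [Group G] [TopologicalSpace G] [IsTopologicalGroup G] [CompactSpace G]
  [TotallyDisconnectedSpace G]

/-- **Cor. 4.5 (v) at the Galois-category instance forces `Z(Π) = 1`**: if item (v) holds for the
archimedean model over `EA = B(Π)` (`T = TF`), then the profinite group `Π` is centre-free — the part of
Lemma 4.3's slimness that item (v) actually detects at this instance.
[cite: MochizukiAbsTopIII2015, Corollary 4.5 (v) p.109] -/
theorem center_eq_bot_of_cor_4_5_v_arch_ofGaloisCategory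
    (h : Literature.AnabelianGeometry.AbsoluteAnabelian.AbsTopIII.Cor_4_5_v
      (archLogFrobeniusData (AutHolFieldFunctor.ofGaloisCategory G))) :
    Subgroup.center G = ⊥ :=
  center_eq_bot_of_isIdRigid_bCat (cor_4_5_v_arch_ofGaloisCategory_iff.1 h)

/-- Negative form: a central `z ≠ 1` of `Π` REFUTES Cor. 4.5 (v) at the Galois-category instance
`B(Π)` (`T = TF`). [cite: MochizukiAbsTopIII2015, Corollary 4.5 (v) p.109] -/
theorem not_cor_4_5_v_arch_ofGaloisCategory_of_mem_center {z : G} (hz : z ∈ Subgroup.center G)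
    (hz1 : z ≠ 1) :
    ¬ Literature.AnabelianGeometry.AbsoluteAnabelian.AbsTopIII.Cor_4_5_v
      (archLogFrobeniusData (AutHolFieldFunctor.ofGaloisCategory G)) :=
  fun h => not_isIdRigid_bCat_of_mem_center hz hz1 (cor_4_5_v_arch_ofGaloisCategory_iff.1 h)

/-- The same at the `TM` model. [cite: MochizukiAbsTopIII2015, Corollary 4.5 (v) p.109] -/
theorem not_cor_4_5_v_arch_TM_ofGaloisCategory_of_mem_center {z : G} (hz : z ∈ Subgroup.center G)
    (hz1 : z ≠ 1) :
    ¬ Literature.AnabelianGeometry.AbsoluteAnabelian.AbsTopIII.Cor_4_5_v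
      (archLogFrobeniusDataTM (AutHolFieldFunctor.ofGaloisCategory G)) :=
  fun h => not_isIdRigid_bCat_of_mem_center hz hz1 (cor_4_5_v_arch_TM_ofGaloisCategory_iff.1 h)

/-- **For every non-trivial ABELIAN profinite group `Π` (e.g. `Ẑ`, the absolute Galois group of a
finite field), Cor. 4.5 (v) FAILS at the Galois-category instance `B(Π)`** — a countermodel to the
typed (v) in the archimedean direction whose `EA` is a genuine Galois category; contrast the slim
instance `cor_4_5_v_arch_ofGaloisCategory`. [cite: MochizukiAbsTopIII2015, Corollary 4.5 (v) p.109] -/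
theorem not_cor_4_5_v_arch_ofGaloisCategory_of_comm {G : Type} [CommGroup G] [TopologicalSpace G]
    [IsTopologicalGroup G] [CompactSpace G] [TotallyDisconnectedSpace G] [Nontrivial G] :
    ¬ Literature.AnabelianGeometry.AbsoluteAnabelian.AbsTopIII.Cor_4_5_v
      (archLogFrobeniusData (AutHolFieldFunctor.ofGaloisCategory G)) := by
  obtain ⟨z, hz1⟩ := exists_ne (1 : G)
  exact not_cor_4_5_v_arch_ofGaloisCategory_of_mem_center
    (Subgroup.mem_center_iff.mpr fun g => mul_comm g z) hz1

/-- A concrete instance: `Π = ℤ/2ℤ` (discrete), `EA = B(ℤ/2ℤ)` the finite `ℤ/2ℤ`-sets — Cor. 4.5 (v)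
fails for the archimedean model over it. [cite: MochizukiAbsTopIII2015, Corollary 4.5 (v) p.109] -/
theorem not_cor_4_5_v_arch_ofGaloisCategory_zmod2 :
    ¬ Literature.AnabelianGeometry.AbsoluteAnabelian.AbsTopIII.Cor_4_5_v
      (archLogFrobeniusData (AutHolFieldFunctor.ofGaloisCategory (Multiplicative (ZMod 2)))) :=
  not_cor_4_5_v_arch_ofGaloisCategory_of_comm

end AbsTopIII

end Literature.AnabelianGeometry.AbsoluteAnabelian
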